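import Literature.NumberTheory.Rogawski1990.ArchBouazizStableFamily       -- ★ (D2-P3) p849717: `stOrbFamH`, `stOrbFamH_of_mem_regS`; ★ `bzExtend`, `stableSum`, `flipSet`; ★ (T-MEAS) `chartOrbH`
import HarnessLib

/-!
# (I₄) for the stable orbital family: `stOrbFamH νH fH` of a COMPACTLY SUPPORTED `fH` has bounded split support — `ArchBzCompactSupport (stOrbFamH L νH fH)`
# (Bouaziz 1994 §3.1 (I₄) p. 579; Shelstad 1979 §4 p. 22; Rogawski 1990 §3.6, §8.3)

Topic `NumberTheory/Rogawski1990`; namespace `Literature.NumberTheory.Rogawski1990`.  THEOREMS ONLY (no `def`, no instance, no notation, no axiom, no named fact, no `sorry`).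
Cell `pub/hodgecm-mathlib`, line LH3 (closer stub `stub_N9`, crux H413 = `stmt-HodgeConjecture-24833`); organ **(D2-I4-st)** (LH3-p01 (g3) DEFAULT 2026-09-02 ≈06:16Z): the clause
(I₄) of ★ `ArchBouazizSpaceH` for the family ★ `stOrbFamH L νH fH` of ANY compactly supported `fH : H_∞ → ℂ` — one of the «observable» conjuncts of the letter O-L3′ (Bouaziz's
Thm. 6.2.1 (i): `J^st_H(𝒟(H_∞)) ⊆ I^st_c`), paid in-house.  Author LH3-p01 (g3).

THE ARGUMENT («compactly supported modulo conjugation»).  At a split place `w ∈ S` the chart point `endoTorus S c` has `U(Φ₂)_w`-block `diag(e^{x+iθ}, e^{−x+iθ})`, `x = c w 0`, whose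
TRACE has absolute value `e^{x} + e^{−x} > |x|`; the trace is a conjugation invariant and is bounded on the compact `tsupport fH` (place by place, continuity).  Hence for `|x|`
beyond that bound NO conjugate of the chart point meets the support: the orbital integrand `y ↦ fH(y·t·y⁻¹)` vanishes identically, so ★ `chartOrbH νH S fH` vanishes at `c` and
at every flip of `c` (flips keep the split slots) — the family is `0` LITERALLY on `RegS S`; on a real wall of another split place it is the `extendFrom`-limit of a function
vanishing near the point, hence `0` (the wall point lies in the closure of `RegS S`: `mem_closure_regS_of_mem_inRegS`); off `InRegS S` it is `0` by definition.
HONEST LABEL: HC_CM is proved only modulo the 7 printed citations (2 remaining: hLiu418 = stmt-HodgeConjecture-24832, h413 = stmt-HodgeConjecture-24833) until rung 0 closes; this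
file pays ONE conjunct of a letter's observable half and changes no count.

## References
* [Bouaziz1994IntegralesOrbitales] A. Bouaziz, *Intégrales orbitales sur les groupes de Lie réductifs*, Ann. Sci. ÉNS 27 (1994) 573–609, §3.1 (I₄) p. 579 («à support compact modulo
  la conjugaison»), Thm. 6.2.1 (i) p. 592.
* [Shelstad1979] D. Shelstad, *Characters and inner forms of a quasi-split group over ℝ*, Compositio Math. 39 (1979), §4 p. 22 (`Φ^T_f` has relatively compact support in `T`).
* [Rogawski1990] J. D. Rogawski, *Automorphic Representations of Unitary Groups in Three Variables*, Ann. of Math. Stud. 123 (1990), §3.6 p. 31 (the split torus), §8.3 p. 122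
  (support of orbital integrals).
-/

set_option autoImplicit false

noncomputable section

open MeasureTheory NumberField NumberField.InfinitePlace Complex Set Function Real Filter Topology
open Literature.NumberTheory.Automorphic Literature.NumberTheory.Automorphic.UnitaryGroup Literature.NumberTheory.Automorphic.ArchCartan Literature.MeasureTheory.Group
open scoped Classical

namespace Literature.NumberTheory.Rogawski1990

/-! ## §1 The real walls lie in the closure of the regular set -/

section Closure

variable {W : Type*}

/-- **Every point of `InRegS S` is a limit of points of `RegS S`**: push the vanishing split coordinates off `0` simultaneously (`c + t·v`, `v` = indicator of the vanishing split
slots, is in `RegS S` for EVERY `t ≠ 0`).  Hence `𝓝[RegS S] c` is non-trivial there and `extendFrom (RegS S)` reads genuine limits on the real walls.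
[cite: Bouaziz1994IntegralesOrbitales, §3.1 p. 579] [cite: Shelstad1979, §4 p. 24] -/
theorem mem_closure_regS_of_mem_inRegS (S : Finset W) {c : W → Fin 3 → ℝ} (hc : c ∈ InRegS S) : c ∈ closure (RegS S) := by
  -- the direction `v`
  obtain ⟨v, hv⟩ : ∃ v : W → Fin 3 → ℝ, v = fun w i => if w ∈ S ∧ i = 0 ∧ c w 0 = 0 then 1 else 0 := ⟨_, rfl⟩
  have hreg : ∀ t : ℝ, t ≠ 0 → c + t • v ∈ RegS S := by
    intro t ht
    refine ⟨fun w hw => ?_, fun w hw => ?_⟩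
    · have h0 : (c + t • v) w 0 = c w 0 := by
        simp only [Pi.add_apply, Pi.smul_apply, hv, smul_eq_mul]
        rw [if_neg (fun h => hw h.1), mul_zero, add_zero]
      have h2 : (c + t • v) w 2 = c w 2 := by
        simp only [Pi.add_apply, Pi.smul_apply, hv, smul_eq_mul]
        rw [if_neg (fun h => absurd h.2.1 (by decide)), mul_zero, add_zero]
      rw [h0, h2]
      exact hc w hw
    · have hval : (c + t • v) w 0 = c w 0 + t * (if w ∈ S ∧ (0 : Fin 3) = 0 ∧ c w 0 = 0 then 1 else 0) := by
        rw [hv]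
        simp only [Pi.add_apply, Pi.smul_apply, smul_eq_mul]
      rw [hval]
      by_cases hx : c w 0 = 0
      · rw [if_pos ⟨hw, rfl, hx⟩, hx, zero_add, mul_one]
        exact ht
      · rw [if_neg (fun h => hx h.2.2), mul_zero, add_zero]
        exact hx
  have hcont : Tendsto (fun t : ℝ => c + t • v) (𝓝[≠] 0) (𝓝 c) := by
    have h : Continuous fun t : ℝ => c + t • v := continuous_const.add (continuous_id.smul continuous_const)
    have h0 := h.tendsto 0
    simp only [zero_smul, add_zero] at h0
    exact h0.mono_left nhdsWithin_le_nhds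
  exact mem_closure_of_tendsto hcont (eventually_nhdsWithin_of_forall fun t ht => hreg t ht)

end Closure

/-! ## §2 The trace of the split block bounds the split coordinate on the support -/

section Trace

variable (L : Type) [Field L]

/-- `|x| < e^{x} + e^{−x}`. [cite: Rogawski1990, §3.6 p. 31] -/
theorem abs_lt_exp_add_exp_neg (x : ℝ) : |x| < Real.exp x + Real.exp (-x) := by
  rcases le_or_gt 0 x with hx | hx
  · rw [abs_of_nonneg hx]
    linarith [Real.add_one_le_exp x, Real.exp_pos (-x)]
  · rw [abs_of_neg hx]
    linarith [Real.add_one_le_exp (-x), Real.exp_pos x]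

/-- The trace of the hyperbolic block `diag(e^{x+iθ}, e^{−x+iθ})` has absolute value `e^{x} + e^{−x}`. [cite: Rogawski1990, §3.6 p. 31] -/
theorem norm_trace_coe_hypBlockGL (x θ : ℝ) : ‖Matrix.trace ((hypBlockGL x θ : GL (Fin 2) ℂ) : Matrix (Fin 2) (Fin 2) ℂ)‖ = Real.exp x + Real.exp (-x) := by
  rw [coe_hypBlockGL, Matrix.trace_fin_two_of]
  have h : Complex.exp ((x : ℂ) + (θ : ℂ) * I) + Complex.exp (-(x : ℂ) + (θ : ℂ) * I) = ((Real.exp x + Real.exp (-x) : ℝ) : ℂ) * Complex.exp ((θ : ℂ) * I) := by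
    rw [Complex.exp_add, Complex.exp_add, ← Complex.ofReal_neg, ← Complex.ofReal_exp, ← Complex.ofReal_exp]
    push_cast
    ring
  rw [h, norm_mul, Complex.norm_exp_ofReal_mul_I, mul_one, Complex.norm_real, Real.norm_eq_abs, abs_of_pos (by positivity)]

/-- At a SPLIT place the trace of the `U(Φ₂)_w`-block of the chart point has absolute value `e^{x_w} + e^{−x_w}`. [cite: Rogawski1990, §3.6 p. 31] -/
theorem norm_trace_coe_endoBlock_of_mem {S : Finset {w : InfinitePlace L // IsComplex w}} (c : {w : InfinitePlace L // IsComplex w} → Fin 3 → ℝ)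
    {w : {w : InfinitePlace L // IsComplex w}} (hw : w ∈ S) :
    ‖Matrix.trace ((endoBlock L S c w : GL (Fin 2) ℂ) : Matrix (Fin 2) (Fin 2) ℂ)‖ = Real.exp (c w 0) + Real.exp (-c w 0) := by
  have h : (endoBlock L S c w : GL (Fin 2) ℂ) = hypBlockGL (c w 0) (c w 2) := by
    unfold endoBlock
    rw [if_pos hw]
  rw [h]
  exact norm_trace_coe_hypBlockGL (c w 0) (c w 2)

end Trace

section Support

variable (L : Type) [Field L] [NumberField L] [IsCMField L]

/-- **The split coordinate is bounded along the conjugates that meet a compact set**: for compact `K ⊆ H_∞` there is `M` such that whenever a conjugate `g·endoTorus S c·g⁻¹` lies in `K`,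
every split coordinate satisfies `|c w 0| ≤ M` (trace of the `w`-block is a conjugation invariant, continuous, hence bounded on `K`, and equals `e^{x}+e^{−x} > |x|` in absolute value).
[cite: Rogawski1990, §8.3 p. 122; §3.6 p. 31] [cite: Shelstad1979, §4 p. 22] -/
theorem exists_bound_split_coord_of_conj_mem
    {K : Set (↥(arch (↥(maximalRealSubfield L)) L (IsCMField.complexConj L) 2 (Matrix.of fun i j : Fin 2 => if i.val + j.val + 1 = 2 then (1 : L) else 0)) ×
      ↥(arch (↥(maximalRealSubfield L)) L (IsCMField.complexConj L) 1 (Matrix.of fun i j : Fin 1 => if i.val + j.val + 1 = 1 then (1 : L) else 0)))}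
    (hK : IsCompact K) :
    ∃ M : ℝ, ∀ (S : Finset {w : InfinitePlace L // IsComplex w}) (c : {w : InfinitePlace L // IsComplex w} → Fin 3 → ℝ)
      (g : ↥(arch (↥(maximalRealSubfield L)) L (IsCMField.complexConj L) 2 (Matrix.of fun i j : Fin 2 => if i.val + j.val + 1 = 2 then (1 : L) else 0)) ×
        ↥(arch (↥(maximalRealSubfield L)) L (IsCMField.complexConj L) 1 (Matrix.of fun i j : Fin 1 => if i.val + j.val + 1 = 1 then (1 : L) else 0))),
      g * endoTorus L S c * g⁻¹ ∈ K → ∀ w ∈ S, |c w 0| ≤ M := by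
  -- the continuous function `h ↦ Σ_w ‖tr(block_w h)‖`
  have hcont : Continuous fun h : ↥(arch (↥(maximalRealSubfield L)) L (IsCMField.complexConj L) 2 (Matrix.of fun i j : Fin 2 => if i.val + j.val + 1 = 2 then (1 : L) else 0)) ×
      ↥(arch (↥(maximalRealSubfield L)) L (IsCMField.complexConj L) 1 (Matrix.of fun i j : Fin 1 => if i.val + j.val + 1 = 1 then (1 : L) else 0)) =>
      ∑ w : {w : InfinitePlace L // IsComplex w},
        ‖Matrix.trace (((archPiEquivCM 2 L (Matrix.of fun i j : Fin 2 => if i.val + j.val + 1 = 2 then (1 : L) else 0) h.1 w :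
          ↥(archLocal L 2 (Matrix.of fun i j : Fin 2 => if i.val + j.val + 1 = 2 then (1 : L) else 0) w)) : GL (Fin 2) ℂ) : Matrix (Fin 2) (Fin 2) ℂ)‖ := by
    refine continuous_finsetSum _ fun w _ => ?_
    refine Continuous.norm ?_
    refine Continuous.matrix_trace ?_
    exact Units.continuous_val.comp (continuous_subtype_val.comp ((continuous_apply w).comp
      ((archPiEquivCM 2 L (Matrix.of fun i j : Fin 2 => if i.val + j.val + 1 = 2 then (1 : L) else 0)).continuous.comp continuous_fst)))
  obtain ⟨M, hM⟩ := hK.exists_bound_of_continuousOn hcont.continuousOn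
  refine ⟨M, fun S c g hg w hw => ?_⟩
  have hle := hM _ hg
  rw [Real.norm_of_nonneg (Finset.sum_nonneg fun _ _ => norm_nonneg _)] at hle
  -- the `w`-summand is `e^{x_w} + e^{−x_w}`
  have hterm : ‖Matrix.trace (((archPiEquivCM 2 L (Matrix.of fun i j : Fin 2 => if i.val + j.val + 1 = 2 then (1 : L) else 0) (g * endoTorus L S c * g⁻¹).1 w :
      ↥(archLocal L 2 (Matrix.of fun i j : Fin 2 => if i.val + j.val + 1 = 2 then (1 : L) else 0) w)) : GL (Fin 2) ℂ) : Matrix (Fin 2) (Fin 2) ℂ)‖ =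
      Real.exp (c w 0) + Real.exp (-c w 0) := by
    have hblock : (archPiEquivCM 2 L (Matrix.of fun i j : Fin 2 => if i.val + j.val + 1 = 2 then (1 : L) else 0) (g * endoTorus L S c * g⁻¹).1 w) =
        (archPiEquivCM 2 L (Matrix.of fun i j : Fin 2 => if i.val + j.val + 1 = 2 then (1 : L) else 0) g.1 w) * endoBlock L S c w *
          (archPiEquivCM 2 L (Matrix.of fun i j : Fin 2 => if i.val + j.val + 1 = 2 then (1 : L) else 0) g.1 w)⁻¹ := by
      rw [Prod.fst_mul, Prod.fst_mul, Prod.fst_inv, map_mul, map_mul, map_inv, Pi.mul_apply, Pi.mul_apply, Pi.inv_apply, archPiEquivCM_endoTorus_fst]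
    rw [hblock, Subgroup.coe_mul, Subgroup.coe_mul, Subgroup.coe_inv, Units.val_mul, Units.val_mul, Matrix.trace_units_conj]
    exact norm_trace_coe_endoBlock_of_mem L c hw
  have hsingle := Finset.single_le_sum (f := fun w : {w : InfinitePlace L // IsComplex w} =>
      ‖Matrix.trace (((archPiEquivCM 2 L (Matrix.of fun i j : Fin 2 => if i.val + j.val + 1 = 2 then (1 : L) else 0) (g * endoTorus L S c * g⁻¹).1 w :
        ↥(archLocal L 2 (Matrix.of fun i j : Fin 2 => if i.val + j.val + 1 = 2 then (1 : L) else 0) w)) : GL (Fin 2) ℂ) : Matrix (Fin 2) (Fin 2) ℂ)‖)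
    (fun _ _ => norm_nonneg _) (Finset.mem_univ w)
  rw [hterm] at hsingle
  linarith [abs_lt_exp_add_exp_neg (c w 0)]

variable
  [MeasurableSpace (↥(arch (↥(maximalRealSubfield L)) L (IsCMField.complexConj L) 2 (Matrix.of fun i j : Fin 2 => if i.val + j.val + 1 = 2 then (1 : L) else 0)) ×
      ↥(arch (↥(maximalRealSubfield L)) L (IsCMField.complexConj L) 1 (Matrix.of fun i j : Fin 1 => if i.val + j.val + 1 = 1 then (1 : L) else 0)))]
  [BorelSpace (↥(arch (↥(maximalRealSubfield L)) L (IsCMField.complexConj L) 2 (Matrix.of fun i j : Fin 2 => if i.val + j.val + 1 = 2 then (1 : L) else 0)) ×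
      ↥(arch (↥(maximalRealSubfield L)) L (IsCMField.complexConj L) 1 (Matrix.of fun i j : Fin 1 => if i.val + j.val + 1 = 1 then (1 : L) else 0)))]
  (νH : Measure (↥(arch (↥(maximalRealSubfield L)) L (IsCMField.complexConj L) 2 (Matrix.of fun i j : Fin 2 => if i.val + j.val + 1 = 2 then (1 : L) else 0)) ×
      ↥(arch (↥(maximalRealSubfield L)) L (IsCMField.complexConj L) 1 (Matrix.of fun i j : Fin 1 => if i.val + j.val + 1 = 1 then (1 : L) else 0))))
  [IsFiniteMeasureOnCompacts νH] [νH.IsMulRightInvariant]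

/-- **The chart orbital functional vanishes when no conjugate of the chart point meets the function's support**: if `fH (g·endoTorus S c·g⁻¹) = 0` for all `g`, then `chartOrbH νH S fH c = 0`
(the `descConj` integrand is identically `0`). [cite: Rogawski1990, §8.3 p. 122] -/
theorem chartOrbH_eq_zero_of_forall_conj (S : Finset {w : InfinitePlace L // IsComplex w})
    (fH : ↥(arch (↥(maximalRealSubfield L)) L (IsCMField.complexConj L) 2 (Matrix.of fun i j : Fin 2 => if i.val + j.val + 1 = 2 then (1 : L) else 0)) ×
      ↥(arch (↥(maximalRealSubfield L)) L (IsCMField.complexConj L) 1 (Matrix.of fun i j : Fin 1 => if i.val + j.val + 1 = 1 then (1 : L) else 0)) → ℂ)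
    (c : {w : InfinitePlace L // IsComplex w} → Fin 3 → ℝ) (h : ∀ g, fH (g * endoTorus L S c * g⁻¹) = 0) : chartOrbH L νH S fH c = 0 := by
  rw [chartOrbH_def]
  have hint : descConj (endoTorus L S c) (chartTorusH L S) (forall_mem_chartTorusH_comm L S c) fH = fun _ => 0 := by
    funext y
    induction y using QuotientGroup.induction_on with
    | H g => rw [descConj_mk, h g]
  rw [hint]
  simp only [integral_zero, mul_zero]

/-- **The normalised stable sum vanishes LITERALLY at a chart coordinate with a large split slot** (`|c w 0| > M`, `M` the bound of `exists_bound_split_coord_of_conj_mem` for `tsupport fH`):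
every flip keeps the split slots, so every summand of the stable sum is `0`. [cite: Bouaziz1994IntegralesOrbitales, §3.1 (I₄) p. 579] -/
theorem archRH_mul_stableSum_chartOrbH_eq_zero (S : Finset {w : InfinitePlace L // IsComplex w})
    (fH : ↥(arch (↥(maximalRealSubfield L)) L (IsCMField.complexConj L) 2 (Matrix.of fun i j : Fin 2 => if i.val + j.val + 1 = 2 then (1 : L) else 0)) ×
      ↥(arch (↥(maximalRealSubfield L)) L (IsCMField.complexConj L) 1 (Matrix.of fun i j : Fin 1 => if i.val + j.val + 1 = 1 then (1 : L) else 0)) → ℂ)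
    {M : ℝ} (hM : ∀ (S : Finset {w : InfinitePlace L // IsComplex w}) (c : {w : InfinitePlace L // IsComplex w} → Fin 3 → ℝ)
      (g : ↥(arch (↥(maximalRealSubfield L)) L (IsCMField.complexConj L) 2 (Matrix.of fun i j : Fin 2 => if i.val + j.val + 1 = 2 then (1 : L) else 0)) ×
        ↥(arch (↥(maximalRealSubfield L)) L (IsCMField.complexConj L) 1 (Matrix.of fun i j : Fin 1 => if i.val + j.val + 1 = 1 then (1 : L) else 0))),
      g * endoTorus L S c * g⁻¹ ∈ tsupport fH → ∀ w ∈ S, |c w 0| ≤ M)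
    {c : {w : InfinitePlace L // IsComplex w} → Fin 3 → ℝ} {w : {w : InfinitePlace L // IsComplex w}} (hw : w ∈ S) (hcw : M < |c w 0|) :
    archRH S c * stableSum S (chartOrbH L νH S fH) c = 0 := by
  have hsum : stableSum S (chartOrbH L νH S fH) c = 0 := by
    unfold stableSum
    refine Finset.sum_eq_zero fun T hT => ?_
    have hT' := not_mem_of_mem_powerset_sdiff hT
    have hflip : (flipSet T c) w 0 = c w 0 := by rw [flipSet_apply_of_not_mem (fun h => hT' w h hw)]
    refine chartOrbH_eq_zero_of_forall_conj L νH S fH (flipSet T c) fun g => ?_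
    refine image_eq_zero_of_notMem_tsupport fun hmem => ?_
    have hle := hM S (flipSet T c) g hmem w hw
    rw [hflip] at hle
    exact absurd hle (not_le.2 hcw)
  rw [hsum, mul_zero]

/-- **(I₄) FOR THE STABLE ORBITAL FAMILY OF A COMPACTLY SUPPORTED FUNCTION**: `ArchBzCompactSupport (stOrbFamH L νH fH)` — with the bound `M` of `exists_bound_split_coord_of_conj_mem` for
`tsupport fH`: if some split slot exceeds `M` the family member is `0` — literally on `RegS S` (`archRH_mul_stableSum_chartOrbH_eq_zero`), as the limit of an eventually-zero function on the
real walls (`mem_closure_regS_of_mem_inRegS` + Mathlib `extendFrom_eq`), by definition off `InRegS S`.  No smoothness and no measure hypothesis beyond the frame's is used.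
[cite: Bouaziz1994IntegralesOrbitales, §3.1 (I₄) p. 579] [cite: Shelstad1979, §4 p. 22] [cite: Rogawski1990, §8.3 p. 122] -/
theorem archBzCompactSupport_stOrbFamH
    (fH : ↥(arch (↥(maximalRealSubfield L)) L (IsCMField.complexConj L) 2 (Matrix.of fun i j : Fin 2 => if i.val + j.val + 1 = 2 then (1 : L) else 0)) ×
      ↥(arch (↥(maximalRealSubfield L)) L (IsCMField.complexConj L) 1 (Matrix.of fun i j : Fin 1 => if i.val + j.val + 1 = 1 then (1 : L) else 0)) → ℂ)
    (hfH : HasCompactSupport fH) : ArchBzCompactSupport (stOrbFamH L νH fH) := by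
  obtain ⟨M, hM⟩ := exists_bound_split_coord_of_conj_mem L hfH.isCompact
  intro S
  refine ⟨M, fun c hc => ?_⟩
  obtain ⟨w, hw, hcw⟩ := hc
  by_cases hcI : c ∈ InRegS S
  · by_cases hcR : c ∈ RegS S
    · -- literal
      rw [stOrbFamH_def, bzExtend_of_mem_regS S _ hcR]
      exact archRH_mul_stableSum_chartOrbH_eq_zero L νH S fH hM hw hcw
    · -- real wall: the extension of an eventually-zero function
      rw [stOrbFamH_def, bzExtend_of_mem_inRegS_of_not_mem_regS S _ hcI hcR]
      refine extendFrom_eq (mem_closure_regS_of_mem_inRegS S hcI) ?_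
      have hcont : Continuous fun c' : {w : InfinitePlace L // IsComplex w} → Fin 3 → ℝ => |c' w 0| :=
        continuous_abs.comp ((continuous_apply 0).comp (continuous_apply w))
      have hU : {c' : {w : InfinitePlace L // IsComplex w} → Fin 3 → ℝ | M < |c' w 0|} ∈ 𝓝 c :=
        (isOpen_lt continuous_const hcont).mem_nhds hcw
      have hev : (fun c' => archRH S c' * stableSum S (chartOrbH L νH S fH) c') =ᶠ[𝓝[RegS S] c] fun _ => (0 : ℂ) := by
        filter_upwards [inter_mem_nhdsWithin (RegS S) hU] with c' hc'
        exact archRH_mul_stableSum_chartOrbH_eq_zero L νH S fH hM hw hc'.2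
      exact tendsto_const_nhds.congr' hev.symm
  · exact stOrbFamH_of_not_mem_inRegS L νH fH S hcI

end Support

end Literature.NumberTheory.Rogawski1990

end
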